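import Mathlib
import Summits.NavierStokesRegularity.NavierStokesRegularity.Theorems.TypeIQuarterGateScarEnvelopeTypeISatelliteTowerGalleryBirkhoff

/-!
# Birkhoff minimal sets for a continuous `(0,1]`-semigroup action on a compact space

NS-free companion of `exists_recurrent_point` (module `…SatelliteTowerGalleryBirkhoff`), used by the
fixed-point normal form of the crux idea `Cruxes/ScarEnvelopeTypeI/Ideas/zoom-recurrence.md`
(ns-idea-17 g0; module `…SatelliteTowerGalleryNormalForm`) on the crux
`TypeIQuarterGate.ScarEnvelopeTypeI` (item 23843): a nonempty compact space with continuous maps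
`T l` (`0 < l ≤ 1`), `T l ∘ T μ = T (l μ)`, contains a nonempty closed invariant MINIMAL set — every
point's ω-limit set `⋂ₖ closure {T l x : 0 < l ≤ 1/(k+1)}` is the whole set (Zorn on nonempty
closed invariant sets + Cantor's intersection theorem). [folklore: Birkhoff 1927; Gottschalk–Hedlund
1955 Thm 2.22]

HONEST FRAMING: abstract tooling; nothing open is proved — 23843 and Navier–Stokes regularity are
OPEN.  LEAD-lineage prover ns-sz-p1 g6; `--supports stmt-NavierStokesRegularity-23843 --as helper`.
-/

-- the summit-side namespace repeats a component by design (single-conjunct summit, D-0017)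
set_option linter.dupNamespace false

open Set Filter Topology

namespace Summit.NavierStokesRegularity.NavierStokesRegularity.Cruxes.ScarEnvelopeTypeI.ZoomDictionary

/-! ### Birkhoff minimal sets -/

section MinimalSet

variable {X : Type*} [TopologicalSpace X]

/-- **Birkhoff MINIMAL SETS (multiplicative semigroup `(0,1]`).**  For continuous maps `T l`
(`0 < l ≤ 1`) of a nonempty compact space with `T l ∘ T μ = T (l μ)` there is a nonempty closed
invariant set `𝓜` such that for EVERY `x ∈ 𝓜` the ω-limit set `⋂ₖ closure {T l x : 0 < l ≤ 1/(k+1)}`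
is all of `𝓜` (in particular every point of `𝓜` is recurrent). -/
theorem exists_minimal_set [CompactSpace X] [Nonempty X] (T : ℝ → X → X)
    (hcont : ∀ l : ℝ, 0 < l → l ≤ 1 → Continuous (T l))
    (hmul : ∀ l μ : ℝ, 0 < l → l ≤ 1 → 0 < μ → μ ≤ 1 → ∀ x, T l (T μ x) = T (l * μ) x) :
    ∃ Mset : Set X, Mset.Nonempty ∧ IsClosed Mset ∧
      (∀ l : ℝ, 0 < l → l ≤ 1 → MapsTo (T l) Mset Mset) ∧
      ∀ x ∈ Mset, (⋂ k : ℕ, closure {y : X | ∃ l : ℝ, 0 < l ∧ l ≤ 1 / ((k : ℝ) + 1) ∧ y = T l x}) = Mset := by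
  classical
  set S : Set (Set X) :=
    {A | A.Nonempty ∧ IsClosed A ∧ ∀ l : ℝ, 0 < l → l ≤ 1 → MapsTo (T l) A A} with hSdef
  have huniv : (univ : Set X) ∈ S := ⟨univ_nonempty, isClosed_univ, fun l _ _ => mapsTo_univ _ _⟩
  have hchain : ∀ c ⊆ S, IsChain (· ⊆ ·) c → c.Nonempty → ∃ lb ∈ S, ∀ s ∈ c, lb ⊆ s := by
    intro c hcS hc hcne
    refine ⟨⋂₀ c, ⟨?_, ?_, ?_⟩, fun s hs => sInter_subset_of_mem hs⟩
    · haveI : Nonempty c := hcne.to_subtype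
      refine IsCompact.nonempty_sInter_of_directed_nonempty_isCompact_isClosed ?_
        (fun A hA => (hcS hA).1) (fun A hA => (hcS hA).2.1.isCompact) (fun A hA => (hcS hA).2.1)
      intro A hA B hB
      by_cases hAB : A = B
      · subst hAB
        exact ⟨A, hA, Subset.rfl, Subset.rfl⟩
      · rcases hc hA hB hAB with h | h
        · exact ⟨A, hA, Subset.rfl, h⟩
        · exact ⟨B, hB, h, Subset.rfl⟩
    · exact isClosed_sInter fun A hA => (hcS hA).2.1
    · intro l hl hl1 y hy
      exact mem_sInter.2 fun A hA => (hcS hA).2.2 l hl hl1 (mem_sInter.1 hy A hA)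
  obtain ⟨M, -, hMmin⟩ := zorn_superset_nonempty S hchain univ huniv
  obtain ⟨hMne, hMcl, hMinv⟩ := hMmin.prop
  refine ⟨M, hMne, hMcl, hMinv, fun x hxM => ?_⟩
  -- the ω-limit set of `x ∈ M` is a member of `S` inside `M`, hence `= M`
  set A : ℕ → Set X := fun k => {y : X | ∃ l : ℝ, 0 < l ∧ l ≤ 1 / ((k : ℝ) + 1) ∧ y = T l x}
    with hAdef
  have hkpos : ∀ k : ℕ, (0 : ℝ) < 1 / ((k : ℝ) + 1) := fun k => by positivity
  have hkle : ∀ k : ℕ, 1 / ((k : ℝ) + 1) ≤ 1 := fun k => by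
    rw [div_le_one (by positivity)]; linarith [(Nat.cast_nonneg k : (0 : ℝ) ≤ k)]
  have hAM : ∀ k, A k ⊆ M := by
    rintro k y ⟨l, hl, hlk, rfl⟩
    exact hMinv l hl (hlk.trans (hkle k)) hxM
  have hAne : ∀ k, (closure (A k)).Nonempty := fun k =>
    ⟨T (1 / ((k : ℝ) + 1)) x, subset_closure ⟨_, hkpos k, le_rfl, rfl⟩⟩
  have hAanti : ∀ k k' : ℕ, k ≤ k' → A k' ⊆ A k := by
    rintro k k' hkk' y ⟨l, hl, hlk, rfl⟩
    refine ⟨l, hl, hlk.trans ?_, rfl⟩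
    exact one_div_le_one_div_of_le (by positivity) (by exact_mod_cast Nat.add_le_add_right hkk' 1)
  have hΩM : (⋂ k, closure (A k)) ⊆ M := fun y hy =>
    hMcl.closure_subset_iff.2 (hAM 0) (mem_iInter.1 hy 0)
  have hΩne : (⋂ k, closure (A k)).Nonempty := by
    refine IsCompact.nonempty_iInter_of_directed_nonempty_isCompact_isClosed _ ?_ hAne
      (fun k => isClosed_closure.isCompact) (fun k => isClosed_closure)
    intro i j
    exact ⟨max i j, closure_mono (hAanti i _ (le_max_left i j)),
      closure_mono (hAanti j _ (le_max_right i j))⟩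
  have hΩcl : IsClosed (⋂ k, closure (A k)) := isClosed_iInter fun k => isClosed_closure
  have hΩinv : ∀ μ : ℝ, 0 < μ → μ ≤ 1 → MapsTo (T μ) (⋂ k, closure (A k)) (⋂ k, closure (A k)) := by
    intro μ hμ hμ1 y hy
    refine mem_iInter.2 fun k => ?_
    have hyk : y ∈ closure (A k) := mem_iInter.1 hy k
    have h1 : T μ '' closure (A k) ⊆ closure (T μ '' A k) :=
      image_closure_subset_closure_image (hcont μ hμ hμ1)
    have h2 : T μ '' A k ⊆ A k := by
      rintro _ ⟨y', ⟨l, hl, hlk, rfl⟩, rfl⟩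
      refine ⟨μ * l, mul_pos hμ hl, ?_, hmul μ l hμ hμ1 hl (hlk.trans (hkle k)) x⟩
      calc μ * l ≤ 1 * l := by gcongr
        _ = l := one_mul l
        _ ≤ _ := hlk
    exact closure_mono h2 (h1 ⟨y, hyk, rfl⟩)
  exact Subset.antisymm hΩM (hMmin.2 ⟨hΩne, hΩcl, hΩinv⟩ hΩM)

end MinimalSet


end Summit.NavierStokesRegularity.NavierStokesRegularity.Cruxes.ScarEnvelopeTypeI.ZoomDictionary
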